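import Summits.Ventures.LatticeQCDFlow.Scaling.IdealStarFreshness

/-!
HONEST FRAMING: exact (Metropolis-corrected) sampling algorithms for lattice gauge theory; figures
of merit are autocorrelation/cost numbers at stated couplings and volumes; no continuum-physics
claim.

# IdealStarMixingCeiling — THE COUPON-COLLECTOR LAW IS ATTAINED: THE IDEALISED HOT-ONLY HUB (ONE LAW AT EVERY LEVEL,
# IDENTITY MAPS, EXACT HOT SAMPLER) ON ANY HUB LIST WITH EVERY HUB EDGE LISTED `≥ c` TIMES HAS
# `d(n) ≤ (K+1)·(1 − t(1−t)c/(2m))ⁿ/t`, HENCE `t_mix(ε) ≤ ⌈(2m/(t(1−t)c))·log((K+1)/(tε))⌉`; WITH THE FLOOR OF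
# `Scaling/HubCollectorLaw`: `(K/t − 1)·log(K/4) ≤ t_mix(1/4) ≤ ⌈(2m/(t(1−t)c))·log(4(K+1)/t)⌉` — THE COLD-START
# MIXING TIME OF THE IDEALISED STAR IS OF ORDER `K·log K` FROM BOTH SIDES (lean-2 GEN-24, ours)

Venture-side (OURS).  Cell `lqcd-flow` (pub-lqcd), unit `pub-lqcd-lean-2-g24`, 2026-08-27.  Chapter L (the coupon-collector
law from a cold start), file 15 — the ceiling side, assembled: `Scaling/IdealStarFreshness` (`‖δ_x Pⁿ − π̃‖_TV ≤
P(D_n ≠ ∅)`) and `Scaling/DirtySetDecay` (`P(D_n ≠ ∅) ≤ (K+1)λⁿ/t`, `λ = 1 − t(1−t)c/(2m)`), against the floor of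
`Scaling/HubCollectorLaw` (`t_mix(1/4) ≥ (K/t − 1)·log(K/4)` from a rare start, which exists once `|S| ≥ 4K`).  The
idealisation isolates the SCHEDULE: perfect transports (every swap accepted) and an exact hot sampler are the best any
flow-assisted exchange scheme can do, and then the cold-start cost is exactly the coupon collector's.

## What is proved

* **`idealStar_worstTvDist_le`** — `d(n) ≤ (K+1)·(1 − t(1−t)c/(2m))ⁿ/t` (`K ≥ 0`, `m ≥ 1`, `0 < t < 1`, `ν > 0`,
  `1 ≤ c ≤ c_p`, `c ≤ m`, cold kernels row-stochastic).
* **`idealStar_worstTvDist_le_of_ge_log`** — `n ≥ (2m/(t(1−t)c))·log((K+1)/(tε))` ⇒ `d(n) ≤ ε`;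
  **`idealStar_mixingTime_le` (THE CEILING)** — `t_mix(ε) ≤ ⌈(2m/(t(1−t)c))·log((K+1)/(tε))⌉`.
* **`idealStar_worstTvDist_sandwich` (THE PROFILE)** — from a start with `Σ_k ν(x_{k+1}) ≤ δ`:
  **`1 − 1/(K(1 − t/K)ⁿ) − δ ≤ d(n) ≤ (K+1)(1 − t(1−t)c/(2m))ⁿ/t`**.
* **`idealStar_mixingTime_two_sided` (THE `K·log K` LAW, BOTH SIDES)** — `K ≥ 2`, cold kernels `ν`-reversible, a
  configuration `x` with `Σ_k ν(x_{k+1}) ≤ 1/4`: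
  **`(K/t − 1)·log(K/4) ≤ t_mix(1/4) ≤ ⌈(2m/(t(1−t)c))·log(4(K+1)/t)⌉`**; `idealStar_mixingTime_two_sided_of_card` —
  the same with the start supplied by `|S| ≥ 4K`; for the plain star (`m = K`, `c = 1`) the two sides are
  `(K/t)·log K` and `(2K/(t(1−t)))·log K` up to the constants inside the logarithms.

Reading (no numerics implied): for exchange schemes over one tunnelling replica the cold-start cost `K·log K` of the
proposal schedule is not an artefact of the lower-bound method: with ideal transports and an ideal hot sampler it is
achieved, with the only losses the factor `2/(1−t)` and the constants in the logarithm.  Real schemes sit above this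
ceiling by their transport defects and hot relaxation (chapter K's `p`, `γ₀`).  NOT CLAIMED: non-identity maps or
unequal laws (the ceiling side uses acceptance one), continuous spaces, anything measured.  Literature grade (cell
rule): OWN RESULT; nothing cited as a fact; no new bib keys.
-/

noncomputable section

open Finset Function
open Literature.Probability.MarkovChains

namespace Summit.Ventures.LatticeQCDFlow.Scaling

variable {S : Type*} [Fintype S] [DecidableEq S] {K m : ℕ} {ν : S → ℝ} {M : Fin (K + 1) → S → S → ℝ} {t : ℝ}

section Ceiling
variable (κ : Fin m → Fin K)

/-- **`d(n) ≤ (K+1)·(1 − t(1−t)c/(2m))ⁿ/t`** for the idealised hot-only hub on the hub list `κ` with every hub edge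
listed at least `c ≥ 1` times. [ours] -/
theorem idealStar_worstTvDist_le (hm : 1 ≤ m) (ht0 : 0 < t) (ht1 : t < 1) (hν : ∀ v, 0 < ν v) (hν1 : ∑ v, ν v = 1)
    (hM : ∀ k, IsRowStochastic (M k)) (hM0 : ∀ u v, M 0 u v = ν v) {c : ℕ} (hc1 : 1 ≤ c)
    (hc : ∀ p : Fin K, c ≤ (univ.filter (fun r : Fin m => κ r = p)).card) (hcm : c ≤ m) (n : ℕ) :
    worstTvDist (fun y z : Fin (K + 1) → S => t * ptGraphSwap (fun _ : Fin (K + 1) => ν)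
          (fun r : Fin m => (((0 : Fin (K + 1)), (κ r).succ) : Fin (K + 1) × Fin (K + 1))) (fun _ => Equiv.refl S) y z
          + (1 - t) * prodKernel (fun k : Fin (K + 1) => if k = 0 then (1 : ℝ) else 0) M y z)
        (tensorFun (fun _ : Fin (K + 1) => ν)) n
      ≤ ((K : ℝ) + 1) * (1 - t * (1 - t) * c / (2 * m)) ^ n / t := by
  set Q : Finset (Fin (K + 1)) → Finset (Fin (K + 1)) → ℝ := fun D D' => ∑ r : Fin m, t / m *
      (if D' = D.image (Equiv.swap (0 : Fin (K + 1)) (κ r).succ) then (1 : ℝ) else 0)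
      + (1 - t) * (if D' = D.erase 0 then (1 : ℝ) else 0) with hQ_def
  have hQ : ∀ D D', Q D D' = ∑ r : Fin m, t / m * (if D' = D.image (Equiv.swap (0 : Fin (K + 1)) (κ r).succ) then (1 : ℝ)
      else 0) + (1 - t) * (if D' = D.erase 0 then (1 : ℝ) else 0) := fun D D' => rfl
  have hstale := dirty_nonempty_le_tuned κ hm ht0 ht1 hQ hc1 hc hcm n
  have hbound : 0 ≤ ((K : ℝ) + 1) * (1 - t * (1 - t) * c / (2 * m)) ^ n / t :=
    le_trans (sum_nonneg fun D _ => lawAt_nonneg (dirty_isRowStochastic κ hm ht0.le ht1.le hQ) (fun U => by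
      by_cases h : U = univ
      · subst h; rw [Pi.single_eq_same]; norm_num
      · rw [Pi.single_eq_of_ne h]) n D) hstale
  refine Real.iSup_le (fun x => ?_) hbound
  exact (ideal_tvDist_le_stale κ hm ht0.le ht1.le hν hν1 hM hM0 hQ x n).trans hstale

/-- **`n ≥ (2m/(t(1−t)c))·log((K+1)/(tε))` ⇒ `d(n) ≤ ε`.** [ours] -/
theorem idealStar_worstTvDist_le_of_ge_log (hm : 1 ≤ m) (ht0 : 0 < t) (ht1 : t < 1) (hν : ∀ v, 0 < ν v)
    (hν1 : ∑ v, ν v = 1) (hM : ∀ k, IsRowStochastic (M k)) (hM0 : ∀ u v, M 0 u v = ν v) {c : ℕ} (hc1 : 1 ≤ c)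
    (hc : ∀ p : Fin K, c ≤ (univ.filter (fun r : Fin m => κ r = p)).card) (hcm : c ≤ m) {ε : ℝ} (hε : 0 < ε) {n : ℕ}
    (hn : 2 * (m : ℝ) / (t * (1 - t) * c) * Real.log (((K : ℝ) + 1) / (t * ε)) ≤ n) :
    worstTvDist (fun y z : Fin (K + 1) → S => t * ptGraphSwap (fun _ : Fin (K + 1) => ν)
          (fun r : Fin m => (((0 : Fin (K + 1)), (κ r).succ) : Fin (K + 1) × Fin (K + 1))) (fun _ => Equiv.refl S) y z
          + (1 - t) * prodKernel (fun k : Fin (K + 1) => if k = 0 then (1 : ℝ) else 0) M y z)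
        (tensorFun (fun _ : Fin (K + 1) => ν)) n ≤ ε := by
  set Q : Finset (Fin (K + 1)) → Finset (Fin (K + 1)) → ℝ := fun D D' => ∑ r : Fin m, t / m *
      (if D' = D.image (Equiv.swap (0 : Fin (K + 1)) (κ r).succ) then (1 : ℝ) else 0)
      + (1 - t) * (if D' = D.erase 0 then (1 : ℝ) else 0) with hQ_def
  have hQ : ∀ D D', Q D D' = ∑ r : Fin m, t / m * (if D' = D.image (Equiv.swap (0 : Fin (K + 1)) (κ r).succ) then (1 : ℝ)
      else 0) + (1 - t) * (if D' = D.erase 0 then (1 : ℝ) else 0) := fun D D' => rfl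
  have hstale := dirty_nonempty_le_of_ge_log κ hm ht0 ht1 hQ hc1 hc hcm hε hn
  refine Real.iSup_le (fun x => ?_) hε.le
  exact (ideal_tvDist_le_stale κ hm ht0.le ht1.le hν hν1 hM hM0 hQ x n).trans hstale

/-- **THE CEILING: `t_mix(ε) ≤ ⌈(2m/(t(1−t)c))·log((K+1)/(tε))⌉`** for the idealised hot-only hub. [ours] -/
theorem idealStar_mixingTime_le (hm : 1 ≤ m) (ht0 : 0 < t) (ht1 : t < 1) (hν : ∀ v, 0 < ν v) (hν1 : ∑ v, ν v = 1)
    (hM : ∀ k, IsRowStochastic (M k)) (hM0 : ∀ u v, M 0 u v = ν v) {c : ℕ} (hc1 : 1 ≤ c)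
    (hc : ∀ p : Fin K, c ≤ (univ.filter (fun r : Fin m => κ r = p)).card) (hcm : c ≤ m) {ε : ℝ} (hε : 0 < ε) :
    mixingTime (fun y z : Fin (K + 1) → S => t * ptGraphSwap (fun _ : Fin (K + 1) => ν)
          (fun r : Fin m => (((0 : Fin (K + 1)), (κ r).succ) : Fin (K + 1) × Fin (K + 1))) (fun _ => Equiv.refl S) y z
          + (1 - t) * prodKernel (fun k : Fin (K + 1) => if k = 0 then (1 : ℝ) else 0) M y z)
        (tensorFun (fun _ : Fin (K + 1) => ν)) ε
      ≤ ⌈2 * (m : ℝ) / (t * (1 - t) * c) * Real.log (((K : ℝ) + 1) / (t * ε))⌉₊ :=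
  mixingTime_le _ _ (idealStar_worstTvDist_le_of_ge_log κ hm ht0 ht1 hν hν1 hM hM0 hc1 hc hcm hε (Nat.le_ceil _))

/-- **THE DISTANCE PROFILE OF THE IDEALISED STAR, BOTH SIDES:** from a configuration `x` with
`Σ_k ν(x_{k+1}) ≤ δ` (`K ≥ 1`): **`1 − 1/(K·(1 − t/K)ⁿ) − δ ≤ d(n) ≤ (K+1)·(1 − t(1−t)c/(2m))ⁿ/t`** — the collector
floor of chapter L (hot-only: `θ_Σ = t`) against the freshness ceiling. [ours] -/
theorem idealStar_worstTvDist_sandwich (hK : 1 ≤ K) (hm : 1 ≤ m) (ht0 : 0 < t) (ht1 : t < 1) (hν : ∀ v, 0 < ν v)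
    (hν1 : ∑ v, ν v = 1) (hM : ∀ k, IsRowStochastic (M k)) (hM0 : ∀ u v, M 0 u v = ν v) {c : ℕ} (hc1 : 1 ≤ c)
    (hc : ∀ p : Fin K, c ≤ (univ.filter (fun r : Fin m => κ r = p)).card) (hcm : c ≤ m) (x : Fin (K + 1) → S)
    {δ : ℝ} (hx : ∑ k : Fin K, ν (x k.succ) ≤ δ) (n : ℕ) :
    1 - 1 / ((K : ℝ) * (1 - t / K) ^ n) - δ
        ≤ worstTvDist (fun y z : Fin (K + 1) → S => t * ptGraphSwap (fun _ : Fin (K + 1) => ν)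
            (fun r : Fin m => (((0 : Fin (K + 1)), (κ r).succ) : Fin (K + 1) × Fin (K + 1))) (fun _ => Equiv.refl S) y z
            + (1 - t) * prodKernel (fun k : Fin (K + 1) => if k = 0 then (1 : ℝ) else 0) M y z)
          (tensorFun (fun _ : Fin (K + 1) => ν)) n ∧
      worstTvDist (fun y z : Fin (K + 1) → S => t * ptGraphSwap (fun _ : Fin (K + 1) => ν)
            (fun r : Fin m => (((0 : Fin (K + 1)), (κ r).succ) : Fin (K + 1) × Fin (K + 1))) (fun _ => Equiv.refl S) y z
            + (1 - t) * prodKernel (fun k : Fin (K + 1) => if k = 0 then (1 : ℝ) else 0) M y z)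
          (tensorFun (fun _ : Fin (K + 1) => ν)) n
        ≤ ((K : ℝ) + 1) * (1 - t * (1 - t) * c / (2 * m)) ^ n / t := by
  refine ⟨?_, idealStar_worstTvDist_le κ hm ht0 ht1 hν hν1 hM hM0 hc1 hc hcm n⟩
  have hKpos : (0 : ℝ) < K := Nat.cast_pos.mpr (by omega)
  have hw0 : ∀ k : Fin (K + 1), 0 ≤ (if k = 0 then (1 : ℝ) else 0) := fun k => by split_ifs <;> norm_num
  have hw1 : ∑ k : Fin (K + 1), (if k = 0 then (1 : ℝ) else 0) = 1 := by
    rw [Finset.sum_ite_eq' univ (0 : Fin (K + 1)), if_pos (mem_univ _)]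
  have hμ : ∀ (k : Fin (K + 1)) (v : S), 0 < (fun _ : Fin (K + 1) => ν) k v := fun _ v => hν v
  -- the hot-only touch sum is at least `K(1 − t/K)ⁿ`
  have hJ := hubList_touchSum_ge κ (w := fun k : Fin (K + 1) => if k = 0 then (1 : ℝ) else 0) (t := t) hK hm hw0 hw1
    ht0.le ht1.le n
  have hθ : t + (1 - t) * (1 - (if (0 : Fin (K + 1)) = 0 then (1 : ℝ) else 0)) = t := by rw [if_pos rfl]; ring
  rw [hθ] at hJ
  have hcold : ∀ k : Fin K, (if k.succ = (0 : Fin (K + 1)) then (1 : ℝ) else 0) = 0 := fun k => if_neg (Fin.succ_ne_zero k)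
  simp_rw [hcold, mul_zero, add_zero] at hJ
  have hpow : 0 < (K : ℝ) * (1 - t / K) ^ n := by
    have : t / K < 1 := (div_lt_one hKpos).mpr (ht1.trans_le (by exact_mod_cast hK))
    positivity
  have hspos : 0 < ∑ k : Fin K, (1 - t * ((univ.filter (fun r : Fin m => κ r = k)).card : ℝ) / m) ^ n :=
    lt_of_lt_of_le hpow hJ
  -- move to the cold levels `T = image succ` in the form of `exchangeScheme_worstTvDist_ge`
  set T : Finset (Fin (K + 1)) := (univ : Finset (Fin K)).image Fin.succ with hT_def
  have hinj : Set.InjOn (Fin.succ : Fin K → Fin (K + 1)) ((univ : Finset (Fin K)) : Set (Fin K)) :=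
    fun a _ b _ hab => Fin.succ_inj.mp hab
  have hsumT : ∑ k ∈ T, (1 - (t * ((univ.filter fun r : Fin m =>
        ((fun r : Fin m => (((0 : Fin (K + 1)), (κ r).succ) : Fin (K + 1) × Fin (K + 1))) r).1 = k ∨
        ((fun r : Fin m => (((0 : Fin (K + 1)), (κ r).succ) : Fin (K + 1) × Fin (K + 1))) r).2 = k).card : ℝ) / m
          + (1 - t) * (if k = 0 then (1 : ℝ) else 0))) ^ n
      = ∑ k : Fin K, (1 - t * ((univ.filter (fun r : Fin m => κ r = k)).card : ℝ) / m) ^ n := by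
    rw [hT_def, Finset.sum_image hinj]
    exact sum_congr rfl fun k _ => by rw [hubList_degree_succ κ k, if_neg (Fin.succ_ne_zero k), mul_zero, add_zero]
  have hmassT : ∑ k ∈ T, (fun _ : Fin (K + 1) => ν) k (x k) = ∑ k : Fin K, ν (x k.succ) := by
    rw [hT_def, Finset.sum_image hinj]
  have hs' : 0 < ∑ k ∈ T, (1 - (t * ((univ.filter fun r : Fin m =>
        ((fun r : Fin m => (((0 : Fin (K + 1)), (κ r).succ) : Fin (K + 1) × Fin (K + 1))) r).1 = k ∨
        ((fun r : Fin m => (((0 : Fin (K + 1)), (κ r).succ) : Fin (K + 1) × Fin (K + 1))) r).2 = k).card : ℝ) / m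
          + (1 - t) * (if k = 0 then (1 : ℝ) else 0))) ^ n := by rw [hsumT]; exact hspos
  have hfloor := exchangeScheme_worstTvDist_ge (μ := fun _ : Fin (K + 1) => ν) (M := M) (φ := fun _ => Equiv.refl S)
    hm (hubList_fst_ne_snd κ) hμ (fun _ => hν1) hM hw0 hw1 ht0.le ht1.le x T (hubList_cold_independent κ) n hs'
  rw [hsumT, hmassT] at hfloor
  have h1s : 1 / (∑ k : Fin K, (1 - t * ((univ.filter (fun r : Fin m => κ r = k)).card : ℝ) / m) ^ n)
      ≤ 1 / ((K : ℝ) * (1 - t / K) ^ n) := one_div_le_one_div_of_le hpow hJ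
  linarith

/-- **THE `K·log K` LAW OF THE IDEALISED STAR, BOTH SIDES:** `K ≥ 2`, `m ≥ 1`, `0 < t < 1`, one positive law `ν` at
every level, identity maps, exact hot sampler, `ν`-reversible row-stochastic cold kernels (never used), every hub edge
listed `≥ c ≥ 1` times, a configuration `x` with `Σ_k ν(x_{k+1}) ≤ 1/4`:
**`(K/t − 1)·log(K/4) ≤ t_mix(1/4) ≤ ⌈(2m/(t(1−t)c))·log(4(K+1)/t)⌉`**. [ours] -/
theorem idealStar_mixingTime_two_sided (hK : 2 ≤ K) (hm : 1 ≤ m) (ht0 : 0 < t) (ht1 : t < 1) (hν : ∀ v, 0 < ν v)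
    (hν1 : ∑ v, ν v = 1) (hM : ∀ k, IsRowStochastic (M k)) (hMrev : ∀ k, DetailedBalance ν (M k))
    (hM0 : ∀ u v, M 0 u v = ν v) {c : ℕ} (hc1 : 1 ≤ c) (hc : ∀ p : Fin K, c ≤ (univ.filter (fun r : Fin m => κ r = p)).card)
    (hcm : c ≤ m) (x : Fin (K + 1) → S) (hx : ∑ k : Fin K, ν (x k.succ) ≤ 1 / 4) :
    ((K : ℝ) / t - 1) * Real.log (K / 4)
        ≤ (mixingTime (fun y z : Fin (K + 1) → S => t * ptGraphSwap (fun _ : Fin (K + 1) => ν)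
            (fun r : Fin m => (((0 : Fin (K + 1)), (κ r).succ) : Fin (K + 1) × Fin (K + 1))) (fun _ => Equiv.refl S) y z
            + (1 - t) * prodKernel (fun k : Fin (K + 1) => if k = 0 then (1 : ℝ) else 0) M y z)
          (tensorFun (fun _ : Fin (K + 1) => ν)) (1 / 4) : ℝ) ∧
      mixingTime (fun y z : Fin (K + 1) → S => t * ptGraphSwap (fun _ : Fin (K + 1) => ν)
            (fun r : Fin m => (((0 : Fin (K + 1)), (κ r).succ) : Fin (K + 1) × Fin (K + 1))) (fun _ => Equiv.refl S) y z
            + (1 - t) * prodKernel (fun k : Fin (K + 1) => if k = 0 then (1 : ℝ) else 0) M y z)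
          (tensorFun (fun _ : Fin (K + 1) => ν)) (1 / 4)
        ≤ ⌈2 * (m : ℝ) / (t * (1 - t) * c) * Real.log (((K : ℝ) + 1) / (t * (1 / 4)))⌉₊ := by
  refine ⟨?_, idealStar_mixingTime_le κ hm ht0 ht1 hν hν1 hM hM0 hc1 hc hcm (by norm_num)⟩
  have hmix : ∃ t₀, worstTvDist (fun y z : Fin (K + 1) → S => t * ptGraphSwap (fun _ : Fin (K + 1) => ν)
      (fun r : Fin m => (((0 : Fin (K + 1)), (κ r).succ) : Fin (K + 1) × Fin (K + 1))) (fun _ => Equiv.refl S) y z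
      + (1 - t) * prodKernel (fun k : Fin (K + 1) => if k = 0 then (1 : ℝ) else 0) M y z)
      (tensorFun (fun _ : Fin (K + 1) => ν)) t₀ ≤ 1 / 4 :=
    ⟨_, idealStar_worstTvDist_le_of_ge_log κ hm ht0 ht1 hν hν1 hM hM0 hc1 hc hcm (by norm_num : (0:ℝ) < 1 / 4)
      (Nat.le_ceil _)⟩
  exact hotOnlyHub_mixingTime_ge κ (fun _ => Equiv.refl S) hK hm (μ := fun _ : Fin (K + 1) => ν) (fun _ v => hν v)
    (fun _ => hν1) hM (fun k => hMrev k) ht0 ht1.le x hx hmix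

/-- **THE `K·log K` LAW ON A LARGE CONFIGURATION SPACE (`|S| ≥ 4K`):** the same two-sided statement with the rare start
supplied. [ours] -/
theorem idealStar_mixingTime_two_sided_of_card (hK : 2 ≤ K) (hS : 4 * K ≤ Fintype.card S) (hm : 1 ≤ m) (ht0 : 0 < t)
    (ht1 : t < 1) (hν : ∀ v, 0 < ν v) (hν1 : ∑ v, ν v = 1) (hM : ∀ k, IsRowStochastic (M k))
    (hMrev : ∀ k, DetailedBalance ν (M k)) (hM0 : ∀ u v, M 0 u v = ν v) {c : ℕ} (hc1 : 1 ≤ c)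
    (hc : ∀ p : Fin K, c ≤ (univ.filter (fun r : Fin m => κ r = p)).card) (hcm : c ≤ m) :
    ((K : ℝ) / t - 1) * Real.log (K / 4)
        ≤ (mixingTime (fun y z : Fin (K + 1) → S => t * ptGraphSwap (fun _ : Fin (K + 1) => ν)
            (fun r : Fin m => (((0 : Fin (K + 1)), (κ r).succ) : Fin (K + 1) × Fin (K + 1))) (fun _ => Equiv.refl S) y z
            + (1 - t) * prodKernel (fun k : Fin (K + 1) => if k = 0 then (1 : ℝ) else 0) M y z)
          (tensorFun (fun _ : Fin (K + 1) => ν)) (1 / 4) : ℝ) ∧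
      mixingTime (fun y z : Fin (K + 1) → S => t * ptGraphSwap (fun _ : Fin (K + 1) => ν)
            (fun r : Fin m => (((0 : Fin (K + 1)), (κ r).succ) : Fin (K + 1) × Fin (K + 1))) (fun _ => Equiv.refl S) y z
            + (1 - t) * prodKernel (fun k : Fin (K + 1) => if k = 0 then (1 : ℝ) else 0) M y z)
          (tensorFun (fun _ : Fin (K + 1) => ν)) (1 / 4)
        ≤ ⌈2 * (m : ℝ) / (t * (1 - t) * c) * Real.log (((K : ℝ) + 1) / (t * (1 / 4)))⌉₊ := by
  obtain ⟨x, hx⟩ := exists_rare_coldStart (μ := fun _ : Fin (K + 1) => ν) (fun _ => hν1) hS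
  exact idealStar_mixingTime_two_sided κ hK hm ht0 ht1 hν hν1 hM hMrev hM0 hc1 hc hcm x hx

end Ceiling

end Summit.Ventures.LatticeQCDFlow.Scaling

end
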